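import Literature.MathematicalPhysics.QuantumFieldTheory.Balaban1983to89.Node00.Record11Carriers
import Literature.MathematicalPhysics.QuantumFieldTheory.Balaban1983to89.B11SectFAssembly
import Summits.QuantumFields.YangMills.Theorems.BalabanUVNodesN07AtRecordCarriersZ

/-!
# BalabanUVNodes ∕ N07 ([B11], `Dag.B11_main`) AT STAGE 11 — the K3 stub `YMDAG.UVSplit.S_N07 Rec := AtRecord Rec Dag.B11_main` READ AT NODE 00's four-pin record
# `Node00.IsRecordOfRecord₁₁CB10YZW` (node00-def g31 `Node00/Record11Carriers` p445559 over def-T's `Node00/Record11` p444286 — the route's key `IsRecordOfRecord₁₁C`):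
# READINGS · KEYED CLOSERS · THE KNIT AT THE BUNDLE OF RECORD FROM PROPOSITION 7 AND THE LOCATED LEAVES OF SECT. F (`B11SectFAssembly.thm1Printed_of_prop7_leaves`
# BY NAME) · CENSUS at ₁₁CB10YZW (the ∀-form junk-refutable through `ResidZ`) · CENSUS at the bare ₁₁C record (N07 undetermined: the [B11] group unpinned there)

Track A of `YM-PLAN.md` (cell `pub-ymgap`, HUMAN RULING D-0062), node **N07** = [Balaban1985Variational] Thm 1 p. 279 + Props 2–9 pp. 281–309; seat `pub-ymgap-dag-n07-a`
(generation 4; -a KNIT-BY-NAME; director R134, FAN-OUT v1.1 §N07 s2; trigger (t7) of `HANDOFF-dag-n07-a` §g3.3); the ₁₁ twin and sequel of this seat's `BalabanUVNodesN07AtRecordCarriersZ`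
(p433511; its record-free reading `b11Leaf_Z11OfRecord_iff` — readings D-n07a-1 «critical ↦ minimal orbit», D-n07a-2 — and dictionary reduction `laws_famXOfRecord` are used, not repeated).  CONTENT consumed BY NAME, nothing restated: g31
`Record11Carriers`, def-T `Record11`, g30 `CarriersZ`, lit-balaban r08 `B11SectFAssembly` (`Leaves`, `prop8Printed_of_leaves`, `sectFPrinted_of_leaves`, **`thm1Printed_of_prop7_leaves`**),
n10-a `B13ResidualSlotProbe9`, n22-b `…N06AtRecord9CB10Y`, this seat's `B11LeafUnpinnedRecord`.  THEOREMS ONLY (0 `def`, 0 `sorry`, standard axioms); COUNT-NEUTRAL;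
`--supports stmt-QuantumFields-19674` (K1 `StabilityBAtRecordR11e`, director LINE №68).

THE STUB AT THESE RECORDS.  At a ₁₁CB10YZW record `Dag.B11_main ℓ := b5 → b6 → b7 → b8 → b9 → b11` has `b5 b6 b7` theorems of the record, `b9` def-Y's leaf at a RESIDUAL operator layer,
`b8` the RESIDUAL [B8] group's leaf, `b11 = B11Leaf (Z11OfRecord F N ζ)` for the presenting RESIDUAL [B11] layer `ζ : ResidZ F N`; the [IV] layer `lamW` rides along (N12's, not read).
* §1 READINGS: `b11_main_iff_leaves_of_isRecordOfRecord₁₁CB10YZW` (N07 ⟺ «b8 → b9 → b11»), `s_N07_iff_leaves₁₁CB10YZW`, `G8a_of_leaf_b11_of_isRecordOfRecord₁₁CB10YZW` (₁₁ twin of g30's face).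
* §2 KEYED CLOSERS: `s_N07_record₁₁CB10YZW_of_leafSlot ∕ _of_bundleSlot` (§4: the bundle hypothesis is FALSE — the ∀-form is NOT a target), `s_N07_of_refines₁₁CB10YZW_of_leaf` and
  `s_N07_of_presented₁₁CB10YZW_of_leaf` (REPAIR SHAPES: the record's own leaf ∕ the presenting package's leaf displayed — the socket §3 feeds), `G8a_of_s_N07_refines₁₁CB10YZW`.
* §3 THE KNIT FROM PROPOSITION 7 AND THE LEAVES OF SECT. F (director R134): **`thm1Printed_Z11OfRecord_of_prop7_leaves`** (Theorem 1 over the family of record ⇐ `B11.Prop7Printed`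
  at `famXOfRecord F N ζ` + `B11SectFAssembly.Leaves` at EVERY member + the two residual dictionary clauses `hcrit ∕ hloc` of p433511, D-B11-2), **`b11Leaf_Z11OfRecord_of_prop7_leaves`**
  (the leaf from Props 2–7, 9 + the leaves: p433511's nine-part pin list with Proposition 8 and the Sect. F conclusion REPLACED by their located leaves),
  `exists_record₁₁CB10YZW_b11_main_of_prop7_leaves` (the ∃-direction at a presented record, end to end).  CROSS-CITATION (cited, NOT imported, NOT restated): the crux
  `MinimiserStabilityRegPr` of route `UnitScaleTilt` (stmt-QuantumFields-19200, cell `ym3-torus`) displays THE SAME printed Proposition 8 p.304 ∕ Sect. F (169) p.305 as its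
  registered stubs `stub_prop8` ∕ `stub_sectF` over the d = 3 carriers `T3Thm1Carrier.famX L` (`UnitScaleTiltMinimiserStabilityRegPrThm1Induction.thm1At_fam_of_prop7_prop8_sectF`);
  here the finer located LEAVES behind both ((152)∧(165), [6] (1.141)–(1.142), locality of (2), [6] (1.36), pp.300–305) are displayed at NODE 00's four-torus objects, the
  dimension letter `d` of the thresholds a parameter (`1 ≤ d`; `4` at these objects, `3` there).
* §4 CENSUS ∕ GUARDS (₁₁CB10YZW): `admissible₁₁_updXYZ ∕ provisos₁₁_updXYZ ∕ datumOfRecord₁₁_updXYZ` (Stage 11 blind to a GENERIC carrier swap `X' Y' Z'` — node-namespaced census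
  plumbing, 1-line terms; the pin algebra's public home is g31's `Record11Carriers`, whose pins fix the swapped values), **`exists_record₁₁CB10YZW_faces`** (b8 VACUOUS by
  empty [B8] indices), `b11Leaf_Z11OfRecord_of_s_N07_record₁₁CB10YZW`, `thm1_family_of_s_N07_record₁₁CB10YZW`, **`not_s_N07_record₁₁CB10YZW_of_params ∕ not_s_N07_record₁₁CB10YZW`**
  (FALSE relative to ONE record — whose existence is def-T's Stage-11 inhabitation, the route's K0, ref-C condition (p₁₁); not reached for), `exists_record₁₁CB10YZW_not_b11_main`,
  `exists_record₁₁CB10YZW_b11_main_iff_leaf` (GENUINE at objects for `k ≥ 1`, NOT junk-closable through `Z`).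
* §5 CENSUS AT THE BARE STAGE-11 RECORD `IsRecordOfRecord₁₁C` (the route's key, rev 1; the [B11] group UNPINNED — `b11` reads the residual `res.Z P`): `b11_main_iff_of_isRecordOfRecord₁₁C`,
  `isRecordOfRecord₁₁C_updXYZ`, `exists_record₁₁C_not_b11_main ∕ exists_record₁₁C_b11_main`, **`b11_main_undetermined_over_record₁₁C`** (junk-refutable AND junk-satisfiable over the SAME
  datum ⇒ a knit of K1 that reads N07 goes through the pinned storey and the leaf's content, §3).
HONEST FRAMING.  [B11]'s Theorem 1 is proved NOWHERE in the tree for `k ≥ 1` (GAPS G₈a-1∕2; `k = 0`: `B11Thm1CarrierTLevelZero`); every field of `Leaves`, Props 2–7, 9 and the two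
residual laws are DISPLAYED; `S_N07` is closed ONLY from displayed slots; N07 NOT discharged (5∕27 untouched); RIDER №22, F8, G-B11-02 (repaired (166′) inside `prop8Printed_of_leaves`),
G-B11-F3 (`holder136` at β₀ = 1) stand; one finite four-torus programme at fixed `ε` — NOT ℝ⁴, NOT infinite volume, NOT OS, NOT a mass gap, NOT Clay.  Restate-immune (no `def`).
-/

noncomputable section

namespace Summit.QuantumFields.YangMills.BalabanUVNodes.N07AtRecord11

open Literature.MathematicalPhysics.QuantumFieldTheory.Balaban1983to89
open Literature.MathematicalPhysics.QuantumFieldTheory.Balaban1983to89.T4Continuum (T4Family FiniteEpsData)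
open Literature.MathematicalPhysics.QuantumFieldTheory.Balaban1983to89.DagBinding
open Literature.MathematicalPhysics.QuantumFieldTheory.Balaban1983to89.Node00
open Literature.MathematicalPhysics.QuantumFieldTheory.Balaban1983to89.B11Thm1 (Thm1At)
open Literature.MathematicalPhysics.QuantumFieldTheory.Balaban1983to89.B11Thm1CarrierT (RegCarrierT varProblemT)
open Literature.MathematicalPhysics.QuantumFieldTheory.Balaban1983to89.B11SectFAssembly (CubeData Leaves)
open YMDAG.UVSplit (RecordPred Datum AtRecord S_N07)
open Summit.QuantumFields.YangMills.BalabanUVNodes.N06AtRecord9CB10Y (exists_junkOps_b9LeafX_Y9OfRecord)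
open Summit.QuantumFields.YangMills.BalabanUVNodes.N07AtRecordCarriersZ (laws_famXOfRecord provisos₁₀_updXYZ)
open scoped Matrix.Norms.L2Operator

variable {N : ℕ} [NeZero N] {F : T4Family} {D : FiniteEpsData F (Node00.SU N)} {w : WorldP}

/-! ## §1 Readings at the four-pin Stage-11 record `IsRecordOfRecord₁₁CB10YZW` -/

/-- **At a ₁₁CB10YZW record N07 IS «b8 → b9 → b11»** (the in-edges `b4 b5 b6 b7` are theorems of the record: this seat's
`B11LeafUnpinnedRecord.b11_main_iff_of_isRecordOfRecord₅C` along g31's `atWorld_of_isRecordOfRecord₁₁CB10YZW`). [cite: Balaban1985Variational, Thm 1 p.279, Props 2–9 pp.281–309 (bookkeeping: the node at a record)] -/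
theorem b11_main_iff_leaves_of_isRecordOfRecord₁₁CB10YZW (h : IsRecordOfRecord₁₁CB10YZW F N D w) (P : B12.RunParams) :
    Dag.B11_main (leavesP w P) ↔ ((leavesP w P).b8 → (leavesP w P).b9 → (leavesP w P).b11) :=
  atWorld_of_isRecordOfRecord₁₁CB10YZW (X := fun ℓ => Dag.B11_main ℓ ↔ (ℓ.b8 → ℓ.b9 → ℓ.b11))
    (fun _ _ h5 P => B11LeafUnpinnedRecord.b11_main_iff_of_isRecordOfRecord₅C h5 P) h P

/-- **WHAT N07's LEAF AT A ₁₁CB10YZW RECORD FEEDS THE STAGE-₈ LAYER** (the ₁₁ twin of g30's ₁₀ face; `CarriersZ.G8a_of_b11Leaf_Z11OfRecord`): def-B's letters `UkExistsR ∧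
UniqueUkOrbitR F N (regB11 F N)` on every torus, level `k ≤ K`, radius `B₃ε₁`, `0 < ε₁ ≤ a₁`, every `V` with (7). [cite: Balaban1985Variational, Thm 1 p.279; Balaban1987RG1, (1.1)–(1.2) p.260] -/
theorem G8a_of_leaf_b11_of_isRecordOfRecord₁₁CB10YZW (h : IsRecordOfRecord₁₁CB10YZW F N D w) {P : B12.RunParams} (hb : (leavesP w P).b11) :
    ∃ C : B11Thm1.Consts, ∀ (K k : ℕ), k ≤ K → ∀ ε₁ : ℝ, 0 < ε₁ → ε₁ ≤ C.a₁ → ∀ V : GaugeField (F.P K) k (SU N), PlaqSmall ε₁ V →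
      UkExistsR F N (regB11 F N) K k (C.B₃ * ε₁) V ∧ UniqueUkOrbitR F N (regB11 F N) K k (C.B₃ * ε₁) V := by
  obtain ⟨θ, Mstar, ops, ζ, lamW, -, -, hl⟩ := leaves_iff_of_isRecordOfRecord₁₁CB10YZW h
  exact G8a_of_b11Leaf_Z11OfRecord (((hl P).2.2.2).1 hb)

/-- **`S_N07` over ₁₁CB10YZW IS «`b8 → b9 → b11` at every run of every record»**. [cite: Balaban1985Variational, Thm 1 p.279, Props 2–9 pp.281–309 (bookkeeping)] -/
theorem s_N07_iff_leaves₁₁CB10YZW :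
    S_N07 (fun F D w => IsRecordOfRecord₁₁CB10YZW F N D w) ↔
      ∀ (F : T4Family) (D : Datum F N) (w : WorldP), IsRecordOfRecord₁₁CB10YZW F N D w →
        ∀ P : B12.RunParams, (leavesP w P).b8 → (leavesP w P).b9 → (leavesP w P).b11 :=
  ⟨fun h F D w hR P => (b11_main_iff_leaves_of_isRecordOfRecord₁₁CB10YZW hR P).1 (h F D w hR P),
    fun h F D w hR P => (b11_main_iff_leaves_of_isRecordOfRecord₁₁CB10YZW hR P).2 (h F D w hR P)⟩

/-! ## §2 Keyed closers BY NAME -/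

/-- **`S_N07 (₁₁CB10YZW)` FROM THE LEAF SLOT, PACKAGE FORM**: the [B11] leaf at `Z11OfRecord F N ζ` for every six-tuple `(θ, h, M⋆, ops, ζ, lamW)` PRESENTING a record gives
`S_N07` (in-edges unused; the slot quantifies over the HIDDEN residual layers — §4 says what the ∀-form costs). [cite: Balaban1985Variational, Thm 1 p.279, Props 2–9 pp.281–309 (bookkeeping)] -/
theorem s_N07_record₁₁CB10YZW_of_leafSlot
    (hslot : ∀ (F : T4Family) (D : Datum F N) (w : WorldP), IsRecordOfRecord₁₁CB10YZW F N D w →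
      ∀ (θ : Stage11Params F N) (hP : θ.Provisos₁₁) (Mstar : ℕ) (ops : OpsY N θ.toStage3Params Mstar) (ζ : ResidZ F N) (lamW : ResidW F N),
        θ.Admissible → D = datumOfRecord₁₁ F N θ hP →
          (∀ P, w.up P = upOfRecord₅C F N (θ.view₁₁B10YZW F N Mstar ops ζ lamW) P) → B11Leaf (Z11OfRecord F N ζ)) :
    S_N07 (fun F D w => IsRecordOfRecord₁₁CB10YZW F N D w) := by
  intro F D w h P
  have hs := hslot F D w h
  obtain ⟨θ, hP, Mstar, ops, ζ, lamW, hθ, hD, -, -, -, hup⟩ := h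
  intro _ _ _ _ _
  show (w.up P).b11
  rw [hup P]
  exact (upOfRecord₅C_view₁₁B10YZW_leaves F N θ Mstar ops ζ lamW P).2.2.2.2 (hs θ hP Mstar ops ζ lamW hθ hD hup)

/-- **`S_N07 (₁₁CB10YZW)` FROM THE LEAF SLOT, BUNDLE FORM** (§4 `b11Leaf_Z11OfRecord_of_s_N07_record₁₁CB10YZW` is the converse; `not_s_N07_record₁₁CB10YZW`: the hypothesis is
FALSE — the ∀-form over ₁₁CB10YZW is NOT an N07 target). [cite: Balaban1985Variational, Thm 1 p.279, Props 2–9 pp.281–309 (bookkeeping)] -/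
theorem s_N07_record₁₁CB10YZW_of_bundleSlot (hslot : ∀ (F : T4Family) (ζ : ResidZ F N), B11Leaf (Z11OfRecord F N ζ)) :
    S_N07 (fun F D w => IsRecordOfRecord₁₁CB10YZW F N D w) :=
  s_N07_record₁₁CB10YZW_of_leafSlot fun F _ _ _ _ _ _ _ ζ _ _ _ _ => hslot F ζ

/-- **THE REPAIR SHAPE ONE STOREY UP**: `S_N07 Rec` for every `Rec` that refines ₁₁CB10YZW and carries the world's own `b11` leaf at every run — what a FURTHER pin (`R` from
genuine cubes, F8, Theorem 1 PROVED at objects — or §3's inputs at the presenting layer) supplies. [cite: Balaban1985Variational, Thm 1 p.279, Props 2–9 pp.281–309 (bookkeeping: the pinned socket)] -/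
theorem s_N07_of_refines₁₁CB10YZW_of_leaf (Rec : RecordPred N)
    (href : ∀ (F : T4Family) (D : Datum F N) (w : WorldP), Rec F D w → IsRecordOfRecord₁₁CB10YZW F N D w)
    (hleaf : ∀ (F : T4Family) (D : Datum F N) (w : WorldP), Rec F D w → ∀ P : B12.RunParams, (leavesP w P).b11) : S_N07 Rec :=
  fun F D w hR P => (b11_main_iff_leaves_of_isRecordOfRecord₁₁CB10YZW (href F D w hR) P).2 fun _ _ => hleaf F D w hR P

/-- **THE REPAIR SHAPE WITH THE PRESENTING PACKAGE DISPLAYED**: `S_N07 Rec` when every `Rec`-record is PRESENTED by a four-pin package `(θ, h, M⋆, ops, ζ, lamW)` (the clauses of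
`IsRecordOfRecord₁₁CB10YZW` verbatim) whose [B11] layer carries the leaf — the socket §3 feeds. [cite: Balaban1985Variational, Thm 1 p.279, Props 2–9 pp.281–309 (bookkeeping: the pinned socket, package form)] -/
theorem s_N07_of_presented₁₁CB10YZW_of_leaf (Rec : RecordPred N)
    (hpres : ∀ (F : T4Family) (D : Datum F N) (w : WorldP), Rec F D w →
      ∃ (θ : Stage11Params F N) (h : θ.Provisos₁₁) (Mstar : ℕ) (ops : OpsY N θ.toStage3Params Mstar) (ζ : ResidZ F N) (lamW : ResidW F N),
        θ.Admissible ∧ D = datumOfRecord₁₁ F N θ h ∧ w.C = D.C ∧ (0 < w.γ ∧ w.γ ≤ θ.γ) ∧ w.L = (θ.L : ℝ) ∧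
          (∀ P, w.up P = upOfRecord₅C F N (θ.view₁₁B10YZW F N Mstar ops ζ lamW) P) ∧ B11Leaf (Z11OfRecord F N ζ)) :
    S_N07 Rec := by
  intro F D w hR P
  obtain ⟨θ, h, Mstar, ops, ζ, lamW, hθ, hD, hC, hγ, hL, hup, hleaf⟩ := hpres F D w hR
  have hrec : IsRecordOfRecord₁₁CB10YZW F N D w := ⟨θ, h, Mstar, ops, ζ, lamW, hθ, hD, hC, hγ, hL, hup⟩
  refine (b11_main_iff_leaves_of_isRecordOfRecord₁₁CB10YZW hrec P).2 fun _ _ => ?_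
  show (w.up P).b11
  rw [hup P]
  exact (upOfRecord₅C_view₁₁B10YZW_leaves F N θ Mstar ops ζ lamW P).2.2.2.2 hleaf

/-- **WHAT `S_N07 Rec` FEEDS THE STAGE-₈ LAYER** for `Rec` refining ₁₁CB10YZW: at every `Rec`-record and run whose in-edges `b8`, `b9` hold, def-B's letters `UkExistsR ∧
UniqueUkOrbitR F N (regB11 F N)` (every torus, `k ≤ K`, radius `B₃ε₁`, `0 < ε₁ ≤ a₁`, `V` with (7)). [cite: Balaban1985Variational, Thm 1 p.279; Balaban1987RG1, (1.1)–(1.2) p.260] -/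
theorem G8a_of_s_N07_refines₁₁CB10YZW (Rec : RecordPred N)
    (href : ∀ (F : T4Family) (D : Datum F N) (w : WorldP), Rec F D w → IsRecordOfRecord₁₁CB10YZW F N D w)
    (hS : S_N07 Rec) (hR : Rec F D w) {P : B12.RunParams} (h8 : (leavesP w P).b8) (h9 : (leavesP w P).b9) :
    ∃ C : B11Thm1.Consts, ∀ (K k : ℕ), k ≤ K → ∀ ε₁ : ℝ, 0 < ε₁ → ε₁ ≤ C.a₁ → ∀ V : GaugeField (F.P K) k (SU N), PlaqSmall ε₁ V →
      UkExistsR F N (regB11 F N) K k (C.B₃ * ε₁) V ∧ UniqueUkOrbitR F N (regB11 F N) K k (C.B₃ * ε₁) V :=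
  G8a_of_leaf_b11_of_isRecordOfRecord₁₁CB10YZW (href F D w hR)
    ((b11_main_iff_leaves_of_isRecordOfRecord₁₁CB10YZW (href F D w hR) P).1 (hS F D w hR P) h8 h9)

/-! ## §3 The knit at the bundle of record from Proposition 7 and the located leaves of Sect. F -/

/-- **THEOREM 1 OVER THE THEOREM-1 FAMILY OF RECORD ⇐ PROPOSITION 7 ∧ THE LOCATED LEAVES OF SECT. F** (`B11SectFAssembly.thm1Printed_of_prop7_leaves` BY NAME — Prop. 8
by the halving iteration of p. 304 over the first case with the repaired (166′), the regularity conclusion (169) with `B₄ = 9dL²B₂B₃`, `M(ε₁) = R₁M₁(a₁/ε₁)`, then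
`B11.thm1_of_prop7_prop8_sectF`): from `B11.Prop7Printed ζ.B₃ ζ.C₁` over the Props-7–8∕Sect.-F family of record, the leaves `B11SectFAssembly.Leaves` at EVERY member (per-cube data
`Dc`; (152)∧(165), [6] (1.141)–(1.142), locality of (2), [6] (1.36) — DISPLAYED, never asserted) and the two residual dictionary clauses at objects (`hcrit`: «minimal ⇒ critical»
for `ζ.IsCrit`; `hloc`: the local-minimum half of the restriction law, D-B11-2; the rest of `VarProblemX.Laws` is p433511's `laws_famXOfRecord`), Theorem 1 over
`(Z11OfRecord F N ζ).famV = fun i ↦ (famXOfRecord F N ζ i).toVarProblem` (BY CONSTRUCTION).  The same printed Prop. 8 ∕ Sect. F are `UnitScaleTilt`'s stubs `stub_prop8` ∕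
`stub_sectF` (stmt-QuantumFields-19200, d = 3; cross-citation, nothing imported). [cite: Balaban1985Variational, Thm 1 p.279, Prop. 7 p.299, Prop. 8 p.304, Sect. F (144)–(169) pp.300–305] -/
theorem thm1Printed_Z11OfRecord_of_prop7_leaves (ζ : ResidZ F N) (Dc : ∀ i : ZIdx, CubeData (famXOfRecord F N ζ i))
    {d L B₁ B₂ K R₁M₁ c₁ a₃ a₄ : ℝ} (hLv : ∀ i, Leaves (famXOfRecord F N ζ i) (Dc i) d L B₁ B₂ ζ.B₃ K R₁M₁ c₁ a₃ a₄)
    (hd : 1 ≤ d) (hL : 0 < L) (hB₁ : 0 < B₁) (hB₂ : 0 < B₂) (hB₃ : 0 < ζ.B₃) (hK : 0 < K) (hR : 1 ≤ R₁M₁) (hc₁ : 0 < c₁) (ha₃ : 0 < a₃)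
    (ha₄ : 0 < a₄) (hC₁ : 0 < ζ.C₁)
    (hcrit : ∀ (i : ZIdx) (e : ℝ) (V : GaugeField (F.P i.K) i.k (SU N)) (U : GaugeField (F.P i.K) 0 (SU N)),
      IsBackground (avOfRecord F N i.K) {U | InUkClassB11 F N i.K i.k e U} i.k V U → ζ.IsCrit i V U)
    (hloc : ∀ (i : ZIdx) (e e' : ℝ) (V : GaugeField (F.P i.K) i.k (SU N)) (U : GaugeField (F.P i.K) 0 (SU N)), e' < e →
      IsBackground (avOfRecord F N i.K) {U | InUkClassB11 F N i.K i.k e' U} i.k V U → IsBackground (avOfRecord F N i.K) {U | InUkClassB11 F N i.K i.k e U} i.k V U)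
    (p7 : B11.Prop7Printed ζ.B₃ ζ.C₁ (famXOfRecord F N ζ)) : B11.Thm1Printed (Z11OfRecord F N ζ).famV :=
  B11SectFAssembly.thm1Printed_of_prop7_leaves (famXOfRecord F N ζ) Dc hLv hd hL hB₁ hB₂ hB₃ hK hR hc₁ ha₃ ha₄ hC₁
    (fun i => laws_famXOfRecord ζ i (hcrit i) (hloc i)) p7

/-- **THE [B11] LEAF AT THE BUNDLE OF RECORD FROM PROPS 2–7, 9 AND THE LOCATED LEAVES OF SECT. F** (p433511's nine-part pin list with Proposition 8 and the Sect. F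
conclusion no longer inputs: `p8` by `prop8Printed_of_leaves`, `sF` by `sectFPrinted_of_leaves`, `t1` by `thm1Printed_Z11OfRecord_of_prop7_leaves`; leaves at the leaf's own `B₁`,
`B₃`, `c₁` as in `B11LeafKnitFull`).  Displayed: Props 2–6 over `ζ.famLG`, Prop. 7 over `famXOfRecord F N ζ`, Prop. 9 over `ζ.famAn`, the leaves, `hcrit ∕ hloc`, sign conditions.
[cite: Balaban1985Variational, Thm 1 p.279, Props 2–9 pp.281–309, Sect. F (144)–(169) pp.300–305] -/
theorem b11Leaf_Z11OfRecord_of_prop7_leaves (ζ : ResidZ F N) (Dc : ∀ i : ZIdx, CubeData (famXOfRecord F N ζ i)) {d L B₂ K R₁M₁ a₃ a₄ : ℝ}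
    (hLv : ∀ i, Leaves (famXOfRecord F N ζ i) (Dc i) d L ζ.B₁ B₂ ζ.B₃ K R₁M₁ ζ.c₁ a₃ a₄)
    (hd : 1 ≤ d) (hL : 0 < L) (hB₂ : 0 < B₂) (hK : 0 < K) (hR : 1 ≤ R₁M₁) (ha₃ : 0 < a₃) (ha₄ : 0 < a₄)
    (hB₁ : 0 < ζ.B₁) (hB₃ : 0 < ζ.B₃) (hC₁ : 0 < ζ.C₁) (hc₁ : 0 < ζ.c₁)
    (hcrit : ∀ (i : ZIdx) (e : ℝ) (V : GaugeField (F.P i.K) i.k (SU N)) (U : GaugeField (F.P i.K) 0 (SU N)),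
      IsBackground (avOfRecord F N i.K) {U | InUkClassB11 F N i.K i.k e U} i.k V U → ζ.IsCrit i V U)
    (hloc : ∀ (i : ZIdx) (e e' : ℝ) (V : GaugeField (F.P i.K) i.k (SU N)) (U : GaugeField (F.P i.K) 0 (SU N)), e' < e →
      IsBackground (avOfRecord F N i.K) {U | InUkClassB11 F N i.K i.k e' U} i.k V U → IsBackground (avOfRecord F N i.K) {U | InUkClassB11 F N i.K i.k e U} i.k V U)
    (p2 : B11.Prop2Printed ζ.B₁ ζ.B₃ ζ.C₁ ζ.c₁ ζ.famLG) (p3 : B11.Prop3Printed ζ.C₁ ζ.B₃ ζ.C₂ ζ.C₃ ζ.B₀ ζ.c1h ζ.c₄ ζ.δ₀ ζ.famLG)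
    (p4 : B11.Prop4Printed ζ.C₁ ζ.B₃ ζ.famLG) (p5 : B11.Prop5Printed ζ.B₁ ζ.B₃ ζ.C₁ ζ.famLG) (p6 : B11.Prop6Printed ζ.B₀ ζ.B₃ ζ.C₁ ζ.famLG)
    (p7 : B11.Prop7Printed ζ.B₃ ζ.C₁ (famXOfRecord F N ζ)) (p9 : B11.Prop9Printed ζ.B₅ ζ.C₁ ζ.β₀ ζ.δ₀ ζ.famAn) :
    B11Leaf (Z11OfRecord F N ζ) :=
  have laws : ∀ i, (famXOfRecord F N ζ i).Laws := fun i => laws_famXOfRecord ζ i (hcrit i) (hloc i)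
  { t1 := thm1Printed_Z11OfRecord_of_prop7_leaves ζ Dc hLv hd hL hB₁ hB₂ hB₃ hK hR hc₁ ha₃ ha₄ hC₁ hcrit hloc p7
    p2 := p2, p3 := p3, p4 := p4, p5 := p5, p6 := p6, p7 := p7
    p8 := B11SectFAssembly.prop8Printed_of_leaves (famXOfRecord F N ζ) Dc hLv hd hL hB₁ hB₃ hK (by linarith) hc₁ ha₃ ha₄ fun i => (laws i).1
    sF := B11SectFAssembly.sectFPrinted_of_leaves (famXOfRecord F N ζ) Dc hLv (by linarith) hL hB₁ hB₂ hB₃ hK hR hc₁ ha₃ ha₄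
    p9 := p9 }

/-! ## §4 Census ∕ guards at ₁₁CB10YZW — why the ∀-form over the four-pin record is not a discharge target -/

/-- Stage-11 admissibility (= Stage-9 admissibility ∧ the §2 sign conditions) is blind to the residual carrier families `X`, `Y`, `Z`.
[cite: Balaban1987RG1, (1.20)–(1.21) p.264; Balaban1988Convergent, (2.34)–(2.39) p.261 (bookkeeping: the admissibility dictionary)] -/
theorem admissible₁₁_updXYZ {θ : Stage11Params F N} (hθ : θ.Admissible) (X' : B12.RunParams → PrintedCarriersR)
    (Y' : B12.RunParams → PrintedCarriers9X) (Z' : B12.RunParams → PrintedCarriers11) :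
    ({ θ with toStage9Params := { θ.toStage9Params with res := { θ.res with X := X', Y := Y', Z := Z' } } } : Stage11Params F N).Admissible :=
  ⟨B13ResidualSlotProbe9.admissible_updXYZ₉ hθ.1 X' Y' Z', hθ.2⟩

/-- The Stage-11 provisos are blind to `X`, `Y`, `Z` (`base` by this seat's ₁₀ lemma; `rzLaws ∕ wtLaws ∕ alphaPos ∕ bg` read the §2 data, the histories and def-R's
background maps only). [cite: Balaban1988Convergent, (2.7) p.255, (2.21) p.258, (2.28) p.259, (3.2)–(3.9) pp.265–266 (the provisos' dictionary; bookkeeping)] -/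
theorem provisos₁₁_updXYZ {θ : Stage11Params F N} (h : θ.Provisos₁₁) (X' : B12.RunParams → PrintedCarriersR)
    (Y' : B12.RunParams → PrintedCarriers9X) (Z' : B12.RunParams → PrintedCarriers11) :
    ({ θ with toStage9Params := { θ.toStage9Params with res := { θ.res with X := X', Y := Y', Z := Z' } } } : Stage11Params F N).Provisos₁₁ :=
  ⟨provisos₁₀_updXYZ h.base X' Y' Z', h.rzLaws, h.wtLaws, h.alphaPos, h.bg⟩

/-- … and so is the Stage-11 DATUM (`rfl`). [cite: Balaban1989LargeFieldII, Thm 1 + (0.1) pp.355–356; Balaban1988Convergent, (0.2) p.244 (the datum's dictionary; bookkeeping)] -/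
theorem datumOfRecord₁₁_updXYZ (θ : Stage11Params F N) (h : θ.Provisos₁₁) (X' : B12.RunParams → PrintedCarriersR)
    (Y' : B12.RunParams → PrintedCarriers9X) (Z' : B12.RunParams → PrintedCarriers11) :
    datumOfRecord₁₁ F N
        ({ θ with toStage9Params := { θ.toStage9Params with res := { θ.res with X := X', Y := Y', Z := Z' } } } : Stage11Params F N)
        (provisos₁₁_updXYZ h X' Y' Z') = datumOfRecord₁₁ F N θ h := rfl

/-- **A ₁₁CB10YZW WORLD PRESENTED BY A GIVEN OPERATOR LAYER, [B11] LAYER AND [IV] LAYER, in-edge `b8` VACUOUS**: every admissible `θ` with its provisos and `γ > 0`, ANY floor,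
`ops`, `ζ`, `lamW` present a ₁₁CB10YZW record over the SAME datum `datumOfRecord₁₁ θ h` ([B8] indices re-keyed EMPTY — `B11LeafUnpinnedRecord.b8LeafR_of_isEmpty`) at every run of
which `b8` HOLDS, `b9 ↔ B9LeafX (Y9OfRecord N θ₃ M⋆ ops)`, `b11 ↔ B11Leaf (Z11OfRecord F N ζ)`. [cite: Balaban1985Variational, Thm 1 p.279; Balaban1985BackgroundPropagators, Thm 3.1 p.397; Balaban1985RegularSpaces, Lemma 1 – Thm 8 pp.79–101 (bookkeeping: the record's faces)] -/
theorem exists_record₁₁CB10YZW_faces (θ : Stage11Params F N) (h : θ.Provisos₁₁) (hθ : θ.Admissible) (hγ : 0 < θ.γ) (Mstar : ℕ)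
    (ops : OpsY N θ.toStage3Params Mstar) (ζ : ResidZ F N) (lamW : ResidW F N) :
    ∃ w : WorldP, IsRecordOfRecord₁₁CB10YZW F N (datumOfRecord₁₁ F N θ h) w ∧ ∀ P : B12.RunParams,
      (leavesP w P).b8 ∧ ((leavesP w P).b9 ↔ B9LeafX (Y9OfRecord N θ.toStage3Params Mstar ops)) ∧
        ((leavesP w P).b11 ↔ B11Leaf (Z11OfRecord F N ζ)) := by
  let X' : B12.RunParams → PrintedCarriersR := fun P =>
    { θ.res.X P with
      I8a := PEmpty, I8b := PEmpty, I8c := PEmpty, I8d := PEmpty, loc8 := fun i => i.elim, fam8 := fun i => i.elim,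
      lan8 := fun i => i.elim, cub8 := fun i => i.elim, toAxial8 := fun i => i.elim, C140 := fun i => i.elim, InR := fun i => i.elim,
      proj140 := fun i => i.elim }
  let θ' : Stage11Params F N :=
    { θ with toStage9Params := { θ.toStage9Params with res := { θ.res with X := X', Y := θ.res.Y, Z := θ.res.Z } } }
  have h' : θ'.Provisos₁₁ := provisos₁₁_updXYZ h X' θ.res.Y θ.res.Z
  have hθ' : θ'.Admissible := admissible₁₁_updXYZ hθ X' θ.res.Y θ.res.Z
  have hD : datumOfRecord₁₁ F N θ' h' = datumOfRecord₁₁ F N θ h := datumOfRecord₁₁_updXYZ θ h X' θ.res.Y θ.res.Z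
  obtain ⟨w₀⟩ := nonempty_worldP
  refine ⟨{ w₀ with
      C := (datumOfRecord₁₁ F N θ' h').C, γ := θ.γ, L := (θ.L : ℝ), one_lt_L := by exact_mod_cast θ.hL.2,
      up := fun P => upOfRecord₅C F N (θ'.view₁₁B10YZW F N Mstar ops ζ lamW) P }, ?_, fun P => ?_⟩
  · rw [← hD]
    exact ⟨θ', h', Mstar, ops, ζ, lamW, hθ', rfl, rfl, ⟨hγ, le_rfl⟩, rfl, fun _ => rfl⟩
  · have hl := upOfRecord₅C_view₁₁B10YZW_leaves F N θ' Mstar ops ζ lamW P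
    refine ⟨?_, hl.2.1, hl.2.2.2⟩
    exact (B11LeafUnpinnedRecord.upOfRecord₅C_b8_b9_b11 (θ'.view₁₁B10YZW F N Mstar ops ζ lamW) P).1.2
      (@B11LeafUnpinnedRecord.b8LeafR_of_isEmpty _ _ _ _ (inferInstance : IsEmpty PEmpty) (inferInstance : IsEmpty PEmpty)
        (inferInstance : IsEmpty PEmpty) (inferInstance : IsEmpty PEmpty) _ _ _ _ _ _ _ _ _ _ _ _ _ _ _)

/-- **THE ∀-FORM FORCES THE [B11] LEAF AT THE BUNDLE OF RECORD OF EVERY RESIDUAL LAYER** (converse of `s_N07_record₁₁CB10YZW_of_bundleSlot` up to the window clause): at the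
record of `exists_record₁₁CB10YZW_faces` with def-Y's JUNK operator layer and any [IV] layer (`nonempty_residW`) the in-edges hold, so N07 there IS the leaf. [cite: Balaban1985Variational, Thm 1 p.279 (bookkeeping)] -/
theorem b11Leaf_Z11OfRecord_of_s_N07_record₁₁CB10YZW (hS : S_N07 (fun F D w => IsRecordOfRecord₁₁CB10YZW F N D w))
    (θ : Stage11Params F N) (h : θ.Provisos₁₁) (hθ : θ.Admissible) (hγ : 0 < θ.γ) (ζ : ResidZ F N) : B11Leaf (Z11OfRecord F N ζ) := by
  obtain ⟨ops, -, hops⟩ := exists_junkOps_b9LeafX_Y9OfRecord (N := N) θ.toStage3Params hθ.1.1.1.1.1 0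
  obtain ⟨lamW⟩ := nonempty_residW F N
  obtain ⟨w, hw, hl⟩ := exists_record₁₁CB10YZW_faces θ h hθ hγ 0 ops ζ lamW
  let P₀ : B12.RunParams := ⟨0, 0, 0⟩
  obtain ⟨h8, h9, h11⟩ := hl P₀
  exact h11.1 ((b11_main_iff_leaves_of_isRecordOfRecord₁₁CB10YZW hw P₀).1 (hS F _ w hw P₀) h8 (h9.2 hops))

/-- **… HENCE THE ∀-FORM ASSERTS THEOREM 1 AT NODE 00's OBJECTS FOR EVERY RESIDUAL REGULARITY DATUM `R`** — degenerate data (one never-gaugeable cube) included,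
which is absurd (next theorem). [cite: Balaban1985Variational, Thm 1 (9)–(10) p.279 (bookkeeping: the typed regularity clause reads residual data)] -/
theorem thm1_family_of_s_N07_record₁₁CB10YZW (hS : S_N07 (fun F D w => IsRecordOfRecord₁₁CB10YZW F N D w))
    (θ : Stage11Params F N) (h : θ.Provisos₁₁) (hθ : θ.Admissible) (hγ : 0 < θ.γ) (R : ∀ i : ZIdx, RegCarrierT F N i.K) :
    ∃ C : B11Thm1.Consts, ∀ i : ZIdx, Thm1At C (varProblemT F N i.K i.k (R i)) := by
  obtain ⟨ζ₀⟩ := nonempty_residZ F N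
  exact exists_thm1At_of_b11Leaf_Z11OfRecord (b11Leaf_Z11OfRecord_of_s_N07_record₁₁CB10YZW hS θ h hθ hγ { ζ₀ with R := R })

/-- **`S_N07` AT `Rec := IsRecordOfRecord₁₁CB10YZW` IS FALSE as soon as ONE admissible Stage-11 parameter with its provisos and `γ > 0` exists** (g30's refuting residual layer
`exists_residZ_not_b11Leaf`): K3's `h7 : S_N07 Rec` is NOT to be instantiated at the four-pin record in ∀-form; the next pin is `R` from genuine cubes (F8) + an object-level
`IsCrit`. [cite: Balaban1985Variational, Thm 1 p.279 (bookkeeping: the universal form over the cumulative record is refutable through the residual layer)] -/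
theorem not_s_N07_record₁₁CB10YZW_of_params (θ : Stage11Params F N) (h : θ.Provisos₁₁) (hθ : θ.Admissible) (hγ : 0 < θ.γ) :
    ¬ S_N07 (fun F D w => IsRecordOfRecord₁₁CB10YZW F N D w) := fun hS => by
  obtain ⟨ζ, hζ⟩ := exists_residZ_not_b11Leaf F N
  exact hζ (b11Leaf_Z11OfRecord_of_s_N07_record₁₁CB10YZW hS θ h hθ hγ ζ)

/-- **Given ONE ₁₁CB10YZW record, a ₁₁CB10YZW record over the SAME datum at every run of which `b8`, `b9` HOLD and N07 FAILS** (junk operator layer, refuting residual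
[B11] layer, empty [B8] indices, the record's own [IV] layer). [cite: Balaban1985Variational, Thm 1 p.279 (bookkeeping over NODE 00's four-pin record)] -/
theorem exists_record₁₁CB10YZW_not_b11_main (hR : IsRecordOfRecord₁₁CB10YZW F N D w) :
    ∃ w' : WorldP, IsRecordOfRecord₁₁CB10YZW F N D w' ∧ ∀ P : B12.RunParams, ¬ Dag.B11_main (leavesP w' P) := by
  obtain ⟨θ, h, Mstar, -, -, lamW, hθ, hD, -, hγ, -, -⟩ := hR
  obtain ⟨ops, -, hops⟩ := exists_junkOps_b9LeafX_Y9OfRecord (N := N) θ.toStage3Params hθ.1.1.1.1.1 Mstar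
  obtain ⟨ζ, hζ⟩ := exists_residZ_not_b11Leaf F N
  obtain ⟨w', hw', hl⟩ := exists_record₁₁CB10YZW_faces θ h hθ (hγ.1.trans_le hγ.2) Mstar ops ζ lamW
  refine ⟨w', by rw [hD]; exact hw', fun P hN => ?_⟩
  obtain ⟨h8, h9, h11⟩ := hl P
  exact hζ (h11.1 ((b11_main_iff_leaves_of_isRecordOfRecord₁₁CB10YZW hw' P).1 hN h8 (h9.2 hops)))

/-- **`S_N07` at ₁₁CB10YZW is FALSE relative to ONE ₁₁CB10YZW record** (any family; the record certifies `θ`, its provisos, admissibility and `0 < w.γ ≤ θ.γ`; whether such a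
record EXISTS is def-T's Stage-11 inhabitation — the route's K0 `Record11Inhabited`, ref-C condition (p₁₁) — not reached for here). [cite: Balaban1985Variational, Thm 1 p.279 (bookkeeping)] -/
theorem not_s_N07_record₁₁CB10YZW (hex : ∃ (F : T4Family) (D : Datum F N) (w : WorldP), IsRecordOfRecord₁₁CB10YZW F N D w) :
    ¬ S_N07 (fun F D w => IsRecordOfRecord₁₁CB10YZW F N D w) := by
  obtain ⟨F, D, w, θ, h, -, -, -, -, hθ, -, -, hγ, -, -⟩ := hex
  exact not_s_N07_record₁₁CB10YZW_of_params θ h hθ (hγ.1.trans_le hγ.2)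

/-- **AT THE JUNK-OPS RECORDS N07 IS EXACTLY THE [B11] LEAF AT THE BUNDLE OF RECORD** (every admissible `θ` with Stage-11 provisos and `γ > 0`, every floor, `ζ`, `lamW`).  NOT
junk-closable: its `t1` is Theorem 1 at NODE 00's OBJECTS over the inhabited `ZIdx` (`k = 0`: `CarriersZ.famV_levelZero_exists8_unique6`; `k ≥ 1`: Bałaban's theorem, GAPS G₈a-1∕2). [cite: Balaban1985Variational, Thm 1 p.279, Props 2–9 pp.281–309] -/
theorem exists_record₁₁CB10YZW_b11_main_iff_leaf (θ : Stage11Params F N) (h : θ.Provisos₁₁) (hθ : θ.Admissible) (hγ : 0 < θ.γ) (Mstar : ℕ)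
    (ζ : ResidZ F N) (lamW : ResidW F N) :
    ∃ w : WorldP, IsRecordOfRecord₁₁CB10YZW F N (datumOfRecord₁₁ F N θ h) w ∧
      ∀ P : B12.RunParams, Dag.B11_main (leavesP w P) ↔ B11Leaf (Z11OfRecord F N ζ) := by
  obtain ⟨ops, -, hops⟩ := exists_junkOps_b9LeafX_Y9OfRecord (N := N) θ.toStage3Params hθ.1.1.1.1.1 Mstar
  obtain ⟨w, hw, hl⟩ := exists_record₁₁CB10YZW_faces θ h hθ hγ Mstar ops ζ lamW
  refine ⟨w, hw, fun P => ?_⟩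
  obtain ⟨h8, h9, h11⟩ := hl P
  rw [b11_main_iff_leaves_of_isRecordOfRecord₁₁CB10YZW hw P, ← h11]
  exact ⟨fun hN => hN h8 (h9.2 hops), fun hb _ _ => hb⟩

/-- **THE DIRECTOR's CONSUMER AT STAGE 11, END TO END**: Props 2–7, 9 + the located leaves of Sect. F + the two residual laws at a residual [B11] layer `ζ` ⇒ N07 HOLDS at every
run of a ₁₁CB10YZW record over `datumOfRecord₁₁ θ h`, every admissible `θ` with its provisos and `γ > 0` (`b11Leaf_Z11OfRecord_of_prop7_leaves` at the junk-ops presentation).  NOT a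
discharge (∃-record, junk in-edges): it certifies that the displayed inputs CLOSE the node's own leaf at NODE 00's objects through print's architecture. [cite: Balaban1985Variational, Thm 1 p.279, Props 2–9 pp.281–309, Sect. F pp.300–305] -/
theorem exists_record₁₁CB10YZW_b11_main_of_prop7_leaves (θ : Stage11Params F N) (h : θ.Provisos₁₁) (hθ : θ.Admissible) (hγ : 0 < θ.γ) (Mstar : ℕ)
    (lamW : ResidW F N) (ζ : ResidZ F N) (Dc : ∀ i : ZIdx, CubeData (famXOfRecord F N ζ i)) {d L B₂ K R₁M₁ a₃ a₄ : ℝ}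
    (hLv : ∀ i, Leaves (famXOfRecord F N ζ i) (Dc i) d L ζ.B₁ B₂ ζ.B₃ K R₁M₁ ζ.c₁ a₃ a₄)
    (hd : 1 ≤ d) (hL : 0 < L) (hB₂ : 0 < B₂) (hK : 0 < K) (hR : 1 ≤ R₁M₁) (ha₃ : 0 < a₃) (ha₄ : 0 < a₄)
    (hB₁ : 0 < ζ.B₁) (hB₃ : 0 < ζ.B₃) (hC₁ : 0 < ζ.C₁) (hc₁ : 0 < ζ.c₁)
    (hcrit : ∀ (i : ZIdx) (e : ℝ) (V : GaugeField (F.P i.K) i.k (SU N)) (U : GaugeField (F.P i.K) 0 (SU N)),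
      IsBackground (avOfRecord F N i.K) {U | InUkClassB11 F N i.K i.k e U} i.k V U → ζ.IsCrit i V U)
    (hloc : ∀ (i : ZIdx) (e e' : ℝ) (V : GaugeField (F.P i.K) i.k (SU N)) (U : GaugeField (F.P i.K) 0 (SU N)), e' < e →
      IsBackground (avOfRecord F N i.K) {U | InUkClassB11 F N i.K i.k e' U} i.k V U → IsBackground (avOfRecord F N i.K) {U | InUkClassB11 F N i.K i.k e U} i.k V U)
    (p2 : B11.Prop2Printed ζ.B₁ ζ.B₃ ζ.C₁ ζ.c₁ ζ.famLG) (p3 : B11.Prop3Printed ζ.C₁ ζ.B₃ ζ.C₂ ζ.C₃ ζ.B₀ ζ.c1h ζ.c₄ ζ.δ₀ ζ.famLG)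
    (p4 : B11.Prop4Printed ζ.C₁ ζ.B₃ ζ.famLG) (p5 : B11.Prop5Printed ζ.B₁ ζ.B₃ ζ.C₁ ζ.famLG) (p6 : B11.Prop6Printed ζ.B₀ ζ.B₃ ζ.C₁ ζ.famLG)
    (p7 : B11.Prop7Printed ζ.B₃ ζ.C₁ (famXOfRecord F N ζ)) (p9 : B11.Prop9Printed ζ.B₅ ζ.C₁ ζ.β₀ ζ.δ₀ ζ.famAn) :
    ∃ w : WorldP, IsRecordOfRecord₁₁CB10YZW F N (datumOfRecord₁₁ F N θ h) w ∧ ∀ P : B12.RunParams, Dag.B11_main (leavesP w P) := by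
  obtain ⟨w, hw, hl⟩ := exists_record₁₁CB10YZW_b11_main_iff_leaf θ h hθ hγ Mstar ζ lamW
  exact ⟨w, hw, fun P => (hl P).2 (b11Leaf_Z11OfRecord_of_prop7_leaves ζ Dc hLv hd hL hB₂ hK hR ha₃ ha₄ hB₁ hB₃ hC₁ hc₁ hcrit hloc p2 p3 p4 p5 p6 p7 p9)⟩

/-! ## §5 Census at the bare Stage-11 record `IsRecordOfRecord₁₁C` (the route's key; the [B11] group unpinned) -/

/-- **At a bare ₁₁C record N07 IS «b8 → b9 → b11»** (def-T's `atWorld_of_isRecordOfRecord₁₁C` by name). [cite: Balaban1985Variational, Thm 1 p.279, Props 2–9 pp.281–309 (bookkeeping: the node at a record)] -/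
theorem b11_main_iff_of_isRecordOfRecord₁₁C (h : IsRecordOfRecord₁₁C F N D w) (P : B12.RunParams) :
    Dag.B11_main (leavesP w P) ↔ ((leavesP w P).b8 → (leavesP w P).b9 → (leavesP w P).b11) :=
  atWorld_of_isRecordOfRecord₁₁C (X := fun ℓ => Dag.B11_main ℓ ↔ (ℓ.b8 → ℓ.b9 → ℓ.b11))
    (fun _ _ h5 P => B11LeafUnpinnedRecord.b11_main_iff_of_isRecordOfRecord₅C h5 P) h P

/-- **Re-binding a bare ₁₁C record's world to carrier-swapped Stage-11 parameters is again a ₁₁C record over the SAME datum** — def-T's predicate pins the 𝐑-carriers `V` and the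
format slot `S218`, NOT the [B8]∕[B9]∕[B11] families (the ₁₁ twin of `B11LeafUnpinnedRecord.isRecordOfRecord₈C_updXYZ`). [cite: Balaban1985Variational, Thm 1 p.279 (bookkeeping: the [B11] group is residual at ₁₁C)] -/
theorem isRecordOfRecord₁₁C_updXYZ (h : IsRecordOfRecord₁₁C F N D w) :
    ∃ (θ : Stage11Params F N) (_ : θ.Provisos₁₁), θ.Admissible ∧ (∀ P, w.up P = upOfRecord₅C F N (θ.toStage5₁₁ F N) P) ∧
      ∀ (X' : B12.RunParams → PrintedCarriersR) (Y' : B12.RunParams → PrintedCarriers9X) (Z' : B12.RunParams → PrintedCarriers11),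
        IsRecordOfRecord₁₁C F N D
          { w with up := fun P => upOfRecord₅C F N (Stage11Params.toStage5₁₁ F N
              ({ θ with toStage9Params := { θ.toStage9Params with res := { θ.res with X := X', Y := Y', Z := Z' } } } : Stage11Params F N)) P } := by
  obtain ⟨θ, hP, hθ, hD, hC, hγ, hL, hup⟩ := h
  refine ⟨θ, hP, hθ, hup, fun X' Y' Z' => ⟨_, provisos₁₁_updXYZ hP X' Y' Z', admissible₁₁_updXYZ hθ X' Y' Z', ?_, hC, hγ, hL, fun _ => rfl⟩⟩
  rw [datumOfRecord₁₁_updXYZ]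
  exact hD

/-- **Given ONE bare ₁₁C record, a ₁₁C record over the SAME datum at which N07 FAILS at every run**: `X ↦` EMPTY [B8] indices (`b8` vacuous), `Y ↦` n06's degenerate [B9] bundle
(`B9LeafKnitNonVacuity.exists_b9LeafX_of_vanishing_operators`), `Z ↦` `B11LeafUnpinnedRecord.exists_not_b11Leaf`. [cite: Balaban1985Variational, Thm 1 p.279 (bookkeeping: the [B11] group is unconstrained at ₁₁C)] -/
theorem exists_record₁₁C_not_b11_main (h : IsRecordOfRecord₁₁C F N D w) :
    ∃ w' : WorldP, IsRecordOfRecord₁₁C F N D w' ∧ ∀ P : B12.RunParams, ¬ Dag.B11_main (leavesP w' P) := by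
  obtain ⟨θ, -, -, -, hrec⟩ := isRecordOfRecord₁₁C_updXYZ h
  obtain ⟨Y₁, -, -, -, hY₁⟩ := B9LeafKnitNonVacuity.exists_b9LeafX_of_vanishing_operators
  obtain ⟨Z₀, -, hZ₀⟩ := B11LeafUnpinnedRecord.exists_not_b11Leaf
  let X' : B12.RunParams → PrintedCarriersR := fun P =>
    { θ.res.X P with
      I8a := PEmpty, I8b := PEmpty, I8c := PEmpty, I8d := PEmpty, loc8 := fun i => i.elim, fam8 := fun i => i.elim,
      lan8 := fun i => i.elim, cub8 := fun i => i.elim, toAxial8 := fun i => i.elim, C140 := fun i => i.elim, InR := fun i => i.elim,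
      proj140 := fun i => i.elim }
  let Y' : B12.RunParams → PrintedCarriers9X := fun _ => Y₁
  refine ⟨_, hrec X' Y' (fun _ => Z₀), fun P hN => hZ₀ ?_⟩
  have hθ' := B11LeafUnpinnedRecord.upOfRecord₅C_b8_b9_b11 (Stage11Params.toStage5₁₁ F N
    ({ θ with toStage9Params := { θ.toStage9Params with res := { θ.res with X := X', Y := Y', Z := fun _ => Z₀ } } } : Stage11Params F N)) P
  have h8 := hθ'.1.2 (@B11LeafUnpinnedRecord.b8LeafR_of_isEmpty _ _ _ _ (inferInstance : IsEmpty PEmpty) (inferInstance : IsEmpty PEmpty)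
      (inferInstance : IsEmpty PEmpty) (inferInstance : IsEmpty PEmpty) _ _ _ _ _ _ _ _ _ _ _ _ _ _ _)
  have h9 := hθ'.2.1.2 hY₁
  exact (hθ'.2.2.1 ((b11_main_iff_of_isRecordOfRecord₁₁C (hrec X' Y' (fun _ => Z₀)) P).1 hN h8 h9) : B11Leaf Z₀)

/-- **Given ONE bare ₁₁C record, a ₁₁C record over the SAME datum at which N07 HOLDS at every run** (vacuously: `Z ↦` the empty-index bundle of
`B11LeafUnpinnedRecord.exists_b11Leaf`; `X`, `Y` unchanged). [cite: Balaban1985Variational, Thm 1 p.279 (bookkeeping: the `∃`-dual is junk-provable)] -/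
theorem exists_record₁₁C_b11_main (h : IsRecordOfRecord₁₁C F N D w) :
    ∃ w' : WorldP, IsRecordOfRecord₁₁C F N D w' ∧ ∀ P : B12.RunParams, Dag.B11_main (leavesP w' P) := by
  obtain ⟨θ, -, -, -, hrec⟩ := isRecordOfRecord₁₁C_updXYZ h
  obtain ⟨Z₀, -, hZ₀⟩ := B11LeafUnpinnedRecord.exists_b11Leaf
  refine ⟨_, hrec θ.res.X θ.res.Y (fun _ => Z₀), fun P => ?_⟩
  exact (b11_main_iff_of_isRecordOfRecord₁₁C (hrec θ.res.X θ.res.Y (fun _ => Z₀)) P).2 fun _ _ =>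
    (B11LeafUnpinnedRecord.upOfRecord₅C_b8_b9_b11 (Stage11Params.toStage5₁₁ F N ({ θ with toStage9Params :=
      { θ.toStage9Params with res := { θ.res with X := θ.res.X, Y := θ.res.Y, Z := fun _ => Z₀ } } } : Stage11Params F N)) P).2.2.2 (hZ₀ : B11Leaf Z₀)

/-- **N07 IS UNDETERMINED OVER THE BARE STAGE-11 RECORD PREDICATE** (the route's key `IsRecordOfRecord₁₁C`, rev 1): over the SAME datum N07 fails at every run of one record and
holds at every run of another — a knit of K1 that READS N07 goes through the pinned storey (§1–§4) and the leaf's content (§3); the ₁₁ twin of `b11_main_undetermined_over_record₈C`. [cite: Balaban1985Variational, Thm 1 p.279 (bookkeeping)] -/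
theorem b11_main_undetermined_over_record₁₁C (h : IsRecordOfRecord₁₁C F N D w) :
    (∃ w' : WorldP, IsRecordOfRecord₁₁C F N D w' ∧ ∀ P : B12.RunParams, ¬ Dag.B11_main (leavesP w' P)) ∧
      ∃ w' : WorldP, IsRecordOfRecord₁₁C F N D w' ∧ ∀ P : B12.RunParams, Dag.B11_main (leavesP w' P) :=
  ⟨exists_record₁₁C_not_b11_main h, exists_record₁₁C_b11_main h⟩

end Summit.QuantumFields.YangMills.BalabanUVNodes.N07AtRecord11

end
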